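import Summits.CriticalPhenomena.PercolationContinuityZ3.Theorems.PercNearOneGluingNoHeavyLowerTailKnQuestion8CoefficientwiseCoreClassKernelMixHubPathCore
import Summits.CriticalPhenomena.PercolationContinuityZ3.Theorems.PercNearOneGluingNoHeavyLowerTailKnQuestion8CoefficientwiseCoreClassKernelMixHubCount
import Summits.CriticalPhenomena.PercolationContinuityZ3.Theorems.PercNearOneGluingNoHeavyLowerTailKnQuestion8CoefficientwiseCoreClassKernelMixHubPathData
import HarnessLib

/-!
# The path lemma for a `j`-gate on the blue side, generic position (PATH LEMMA of hub-Kleitman, memo §1.1–1.3, §2.6)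

Support file (`--supports stmt-CriticalPhenomena-4575`, closed), prover `prim-cplus-coupling` (gen 51).  No definitions, no notations,
no named facts, no sorries; standard axioms.  Memo `prim-cplus-coupling/A5-COUPLING-gen51.md` §1 (reformulation chain), §2.6;
memo-50 §2.8 (statement of the PATH LEMMA).

THE STATEMENT (`hubPath_generic`).  Words `ω ⊆ [1, ℓ]` = red edges of the path `u = w₀, …, w_ℓ = b`; runs: `ri` = leading red run,
`ra` = leading blue run, `rj` / `rb` = trailing red / blue runs (given by their wall formulas, hypotheses `hri …`; vertex `w_k` has
index `k`).  Up-sets `𝒳, 𝒴` of vertex sets (`X, Y` monotone predicates).  The red-side value is any monotone `VX (ri) (rj)` (for the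
`u`-gate `VX i j = [0, i] = C_u`, for the `j`-gate `VX i j = [0, i] ∪ [ℓ-j, ℓ] = C_u ∪ C_b`); the blue-side value is the `j`-gate
`[0, ra] ∪ [ℓ-rb, ℓ]` of the complementary word.  `W = {𝒳-value ∉ 𝒳, 𝒴-value of the complement ∈ 𝒴}`, `cW` = its complement-
conjugate.  GENERIC POSITION: `VX 0 0 ∉ 𝒳`, `{w₀, w_ℓ} ∉ 𝒴`, `V ∈ 𝒴` (memo §1.2; the other positions are trivial or reduce to this one).
For every family `F` of words closed under HUB MOVES (prefix fills into the leading blue run, suffix fills into the trailing blue run):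
`#(F ∩ W) ≤ #(F ∩ cW)`.
PROOF: the staircase `om x = max{y : [0,x] ∪ [y,ℓ] ∈ 𝒴}`, the cells `A = P ∖ Q`, `B = Q ∖ P` with `P(x,y) = (VX x 0 ∉ 𝒳 ∧ {0} ∪ [y,ℓ] ∈ 𝒴)`,
`Q(x,y) = (VX 0 (ℓ-y) ∉ 𝒳 ∧ [0,x] ∪ {ℓ} ∈ 𝒴)` (memo §1.3: `𝒟` enters through `P`, `U` through `om` and `Q`); the sources `W ∖ cW` and
targets `cW ∖ W` are exactly the `S`, `T` of `…HubPathCore` (level by level), whose injection along moves feeds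
`hub_card_filter_le_of_moveInjection` (`…HubCount`).
[cite: KozmaNitzan2024, Questions 8–9 (§5.5 p. 36) (context)]
-/

namespace Summit.CriticalPhenomena.PercolationContinuityZ3.Theorems

open Finset
open scoped symmDiff

namespace Coefficientwise

open Classical in
/-- **PATH LEMMA, `j`-gate on the blue side, generic position** (memo-50 §2.8 / memo-51 §2.6 for the gate types `(u,j)`, `(j,j)`):
`#(F ∩ W) ≤ #(F ∩ cW)` for every hub-move-closed family `F` of words. [folklore] -/
theorem hubPath_generic (ℓ : ℕ) (hℓ : 2 ≤ ℓ)
    (X Y : Finset ℕ → Prop) (hXmono : ∀ S T : Finset ℕ, S ⊆ T → X S → X T)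
    (hYmono : ∀ S T : Finset ℕ, S ⊆ T → Y S → Y T)
    (VX : ℕ → ℕ → Finset ℕ) (hVX : ∀ i j i' j', i ≤ i' → j ≤ j' → VX i j ⊆ VX i' j')
    (hX0 : ¬ X (VX 0 0)) (hY0 : ¬ Y (Icc 0 0 ∪ Icc ℓ ℓ)) (hY1 : Y (Icc 0 ℓ))
    (D : Finset ℕ → Finset ℕ) (hD : ∀ ω, D ω = (Icc 1 (ℓ - 1)).filter (fun k => ¬ (k ∈ ω ↔ k + 1 ∈ ω)))
    (ri ra rj rb : Finset ℕ → ℕ)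
    (hri : ∀ ω, ri ω = if 1 ∈ ω then (if h : (D ω).Nonempty then (D ω).min' h else ℓ) else 0)
    (hra : ∀ ω, ra ω = if 1 ∈ ω then 0 else (if h : (D ω).Nonempty then (D ω).min' h else ℓ))
    (hrj : ∀ ω, rj ω = if ℓ ∈ ω then (if h : (D ω).Nonempty then ℓ - (D ω).max' h else ℓ) else 0)
    (hrb : ∀ ω, rb ω = if ℓ ∈ ω then 0 else (if h : (D ω).Nonempty then ℓ - (D ω).max' h else ℓ))
    (W cW : Finset ℕ → Prop)
    (hW : ∀ ω, W ω ↔ ¬ X (VX (ri ω) (rj ω)) ∧ Y (Icc 0 (ra ω) ∪ Icc (ℓ - rb ω) ℓ))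
    (hcW : ∀ ω, cW ω ↔ ¬ X (VX (ra ω) (rb ω)) ∧ Y (Icc 0 (ri ω) ∪ Icc (ℓ - rj ω) ℓ))
    (F : Finset (Finset ℕ)) (hFsub : ∀ ω ∈ F, ω ⊆ Icc 1 ℓ)
    (hFup : ∀ ω ∈ F, ∀ a b : ℕ, a ≤ b → b ≤ ℓ → (∀ k ∈ ω, a < k) → (∀ k ∈ ω, k ≤ b) →
      ω ∪ Icc 1 a ∪ Icc (b + 1) ℓ ∈ F) :
    (F.filter (fun ω => W ω)).card ≤ (F.filter (fun ω => cW ω)).card := by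
  classical
  have hℓ1 : 1 ≤ ℓ := by omega
  have hD0 := hubPath_zero_notMem_walls ℓ D hD
  have hDle := hubPath_walls_le ℓ D hD
  have hDge := hubPath_walls_ge ℓ D hD
  ------------------------------------------------------------------ the staircase and the filters (…HubPathData)
  obtain ⟨om, hstair, hmono, homY⟩ := hubPath_staircase ℓ Y hYmono hY1
  obtain ⟨P, hP⟩ : ∃ P : ℕ → ℕ → Prop, ∀ x y, P x y ↔ ¬ X (VX x 0) ∧ Y (Icc 0 0 ∪ Icc y ℓ) :=
    ⟨_, fun _ _ => Iff.rfl⟩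
  obtain ⟨Q, hQ⟩ : ∃ Q : ℕ → ℕ → Prop, ∀ x y, Q x y ↔ ¬ X (VX 0 (ℓ - y)) ∧ Y (Icc 0 x ∪ Icc ℓ ℓ) :=
    ⟨_, fun _ _ => Iff.rfl⟩
  have hPanti : ∀ x y x' y', x' ≤ x → y' ≤ y → P x y → P x' y' := by
    intro x y x' y' hx hy h
    rw [hP] at h ⊢
    refine ⟨fun h' => h.1 (hXmono _ _ (hVX _ _ _ _ hx (le_refl _)) h'), hYmono _ _ ?_ h.2⟩
    exact Finset.union_subset_union (Finset.Subset.refl _) (Finset.Icc_subset_Icc_left hy)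
  have hQmono : ∀ x y x' y', x ≤ x' → y ≤ y' → y' ≤ ℓ → Q x y → Q x' y' := by
    intro x y x' y' hx hy hy' h
    rw [hQ] at h ⊢
    refine ⟨fun h' => h.1 (hXmono _ _ (hVX _ _ _ _ (le_refl _) (by omega)) h'), hYmono _ _ ?_ h.2⟩
    exact Finset.union_subset_union (Finset.Icc_subset_Icc_right hx) (Finset.Subset.refl _)
  obtain ⟨A, B, hmemA, hmemB, hAcell, hAdown, hBcell, hBup, hAB⟩ := hubPath_filters ℓ om Y hYmono homY P Q hPanti
    hQmono (fun x y h => ((hP x y).mp h).2) (fun x y h => ((hQ x y).mp h).2)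
  ------------------------------------------------------------------ sources and targets, level by level
  obtain ⟨S, hS⟩ : ∃ S : Finset ℕ → Prop, ∀ ω, S ω ↔ ω ⊆ Icc 1 ℓ ∧ W ω ∧ ¬ cW ω := ⟨_, fun _ => Iff.rfl⟩
  obtain ⟨T, hT⟩ : ∃ T : Finset ℕ → Prop, ∀ ω, T ω ↔ ω ⊆ Icc 1 ℓ ∧ cW ω ∧ ¬ W ω := ⟨_, fun _ => Iff.rfl⟩
  -- the values at each level
  have hlevels : ∀ ω, ω ⊆ Icc 1 ℓ →
      (W ω ↔ ((1 ∉ ω ∧ ℓ ∉ ω ∧ (D ω = ∅ ∨ ∃ h : (D ω).Nonempty, (D ω).max' h ≤ om ((D ω).min' h))) ∨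
              (1 ∈ ω ∧ ℓ ∉ ω ∧ ∃ h : (D ω).Nonempty, P ((D ω).min' h) ((D ω).max' h)) ∨
              (1 ∉ ω ∧ ℓ ∈ ω ∧ ∃ h : (D ω).Nonempty, Q ((D ω).min' h) ((D ω).max' h)))) ∧
      (cW ω ↔ ((1 ∈ ω ∧ ℓ ∈ ω ∧ (D ω = ∅ ∨ ∃ h : (D ω).Nonempty, (D ω).max' h ≤ om ((D ω).min' h))) ∨
              (1 ∈ ω ∧ ℓ ∉ ω ∧ ∃ h : (D ω).Nonempty, Q ((D ω).min' h) ((D ω).max' h)) ∨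
              (1 ∉ ω ∧ ℓ ∈ ω ∧ ∃ h : (D ω).Nonempty, P ((D ω).min' h) ((D ω).max' h)))) := by
    intro ω hω
    have hpar := hubPath_even_walls_iff ℓ hℓ1 D hD ω
    have hℓ0 : ℓ - 0 = ℓ := rfl
    rw [hW, hcW, hri, hra, hrj, hrb]
    by_cases h1 : 1 ∈ ω <;> by_cases hl : ℓ ∈ ω
    · -- RR
      simp only [if_pos h1, if_pos hl]
      by_cases hDn : (D ω).Nonempty
      · simp only [dif_pos hDn]
        have hm := hDge ω _ ((D ω).min'_mem hDn)
        have hM := hDle ω _ ((D ω).max'_mem hDn)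
        have hmm : (D ω).min' hDn ≤ ℓ - 1 := hDle ω _ ((D ω).min'_mem hDn)
        have e : ℓ - (ℓ - (D ω).max' hDn) = (D ω).max' hDn := by omega
        rw [e, hℓ0, ← homY ((D ω).min' hDn) ((D ω).max' hDn) (by omega) (by omega)]
        constructor
        · constructor
          · rintro ⟨_, h⟩; exact absurd h hY0
          · rintro (⟨h, _⟩ | ⟨_, h, _⟩ | ⟨h, _⟩)
            · exact absurd h1 h
            · exact absurd hl h
            · exact absurd h1 h
        · constructor
          · rintro ⟨_, h⟩; exact Or.inl ⟨h1, hl, Or.inr ⟨hDn, h⟩⟩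
          · rintro (⟨_, _, h⟩ | ⟨_, h, _⟩ | ⟨h, _⟩)
            · rcases h with h | ⟨_, h⟩
              · exact absurd h (Finset.nonempty_iff_ne_empty.mp hDn)
              · exact ⟨hX0, h⟩
            · exact absurd hl h
            · exact absurd h1 h
      · simp only [dif_neg hDn]
        rw [hℓ0, Nat.sub_self]
        have hD' : D ω = ∅ := Finset.not_nonempty_iff_eq_empty.mp hDn
        have hYtop : Y (Icc 0 ℓ ∪ Icc 0 ℓ) := by rw [Finset.union_idempotent]; exact hY1
        constructor
        · constructor
          · rintro ⟨_, h⟩; exact absurd h hY0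
          · rintro (⟨h, _⟩ | ⟨_, h, _⟩ | ⟨h, _⟩)
            · exact absurd h1 h
            · exact absurd hl h
            · exact absurd h1 h
        · constructor
          · rintro _; exact Or.inl ⟨h1, hl, Or.inl hD'⟩
          · rintro _; exact ⟨hX0, hYtop⟩
    · -- RB
      simp only [if_pos h1, if_neg hl]
      have hDn : (D ω).Nonempty := by
        rw [Finset.nonempty_iff_ne_empty]; intro h0
        have : Even (D ω).card := by rw [h0]; simp
        exact hl ((hpar.mp this).mp h1)
      simp only [dif_pos hDn]
      have hm := hDge ω _ ((D ω).min'_mem hDn)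
      have hM := hDle ω _ ((D ω).max'_mem hDn)
      have e : ℓ - (ℓ - (D ω).max' hDn) = (D ω).max' hDn := by omega
      rw [e, hℓ0, ← hP, ← hQ]
      constructor
      · constructor
        · intro h; exact Or.inr (Or.inl ⟨h1, hl, hDn, h⟩)
        · rintro (⟨h, _⟩ | ⟨_, _, _, h⟩ | ⟨h, _⟩)
          · exact absurd h1 h
          · exact h
          · exact absurd h1 h
      · constructor
        · intro h; exact Or.inr (Or.inl ⟨h1, hl, hDn, h⟩)
        · rintro (⟨_, h, _⟩ | ⟨_, _, _, h⟩ | ⟨h, _⟩)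
          · exact absurd h hl
          · exact h
          · exact absurd h1 h
    · -- BR
      simp only [if_neg h1, if_pos hl]
      have hDn : (D ω).Nonempty := by
        rw [Finset.nonempty_iff_ne_empty]; intro h0
        have : Even (D ω).card := by rw [h0]; simp
        exact h1 ((hpar.mp this).mpr hl)
      simp only [dif_pos hDn]
      have hm := hDge ω _ ((D ω).min'_mem hDn)
      have hM := hDle ω _ ((D ω).max'_mem hDn)
      have e : ℓ - (ℓ - (D ω).max' hDn) = (D ω).max' hDn := by omega
      rw [e, hℓ0, ← hP, ← hQ]
      constructor
      · constructor
        · intro h; exact Or.inr (Or.inr ⟨h1, hl, hDn, h⟩)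
        · rintro (⟨_, h, _⟩ | ⟨h, _⟩ | ⟨_, _, _, h⟩)
          · exact absurd hl h
          · exact absurd h h1
          · exact h
      · constructor
        · intro h; exact Or.inr (Or.inr ⟨h1, hl, hDn, h⟩)
        · rintro (⟨h, _⟩ | ⟨h, _⟩ | ⟨_, _, _, h⟩)
          · exact absurd h h1
          · exact absurd h h1
          · exact h
    · -- BB
      simp only [if_neg h1, if_neg hl]
      by_cases hDn : (D ω).Nonempty
      · simp only [dif_pos hDn]
        have hm := hDge ω _ ((D ω).min'_mem hDn)
        have hM := hDle ω _ ((D ω).max'_mem hDn)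
        have hmm : (D ω).min' hDn ≤ ℓ - 1 := hDle ω _ ((D ω).min'_mem hDn)
        have e : ℓ - (ℓ - (D ω).max' hDn) = (D ω).max' hDn := by omega
        rw [e, hℓ0, ← homY ((D ω).min' hDn) ((D ω).max' hDn) (by omega) (by omega)]
        constructor
        · constructor
          · rintro ⟨_, h⟩; exact Or.inl ⟨h1, hl, Or.inr ⟨hDn, h⟩⟩
          · rintro (⟨_, _, h⟩ | ⟨h, _⟩ | ⟨_, h, _⟩)
            · rcases h with h | ⟨_, h⟩
              · exact absurd h (Finset.nonempty_iff_ne_empty.mp hDn)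
              · exact ⟨hX0, h⟩
            · exact absurd h h1
            · exact absurd h hl
        · constructor
          · rintro ⟨_, h⟩; exact absurd h hY0
          · rintro (⟨h, _⟩ | ⟨h, _⟩ | ⟨_, h, _⟩)
            · exact absurd h h1
            · exact absurd h h1
            · exact absurd h hl
      · simp only [dif_neg hDn]
        rw [hℓ0, Nat.sub_self]
        have hD' : D ω = ∅ := Finset.not_nonempty_iff_eq_empty.mp hDn
        have hYtop : Y (Icc 0 ℓ ∪ Icc 0 ℓ) := by rw [Finset.union_idempotent]; exact hY1
        constructor
        · constructor
          · rintro _; exact Or.inl ⟨h1, hl, Or.inl hD'⟩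
          · rintro _; exact ⟨hX0, hYtop⟩
        · constructor
          · rintro ⟨_, h⟩; exact absurd h hY0
          · rintro (⟨h, _⟩ | ⟨h, _⟩ | ⟨_, h, _⟩)
            · exact absurd h h1
            · exact absurd h h1
            · exact absurd h hl
  -- S and T in the form of …HubPathCore
  have hS' : ∀ ω, S ω ↔ ω ⊆ Icc 1 ℓ ∧
      ((1 ∉ ω ∧ ℓ ∉ ω ∧ (D ω = ∅ ∨ ∃ h : (D ω).Nonempty, (D ω).max' h ≤ om ((D ω).min' h))) ∨
       (1 ∈ ω ∧ ℓ ∉ ω ∧ ∃ h : (D ω).Nonempty, ((D ω).min' h, (D ω).max' h) ∈ A) ∨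
       (1 ∉ ω ∧ ℓ ∈ ω ∧ ∃ h : (D ω).Nonempty, ((D ω).min' h, (D ω).max' h) ∈ B)) := by
    intro ω
    rw [hS]
    refine and_congr_right fun hω => ?_
    obtain ⟨hWl, hcWl⟩ := hlevels ω hω
    rw [hWl, hcWl]
    by_cases h1 : 1 ∈ ω <;> by_cases hl : ℓ ∈ ω
    · constructor
      · rintro ⟨(⟨h, _⟩ | ⟨_, h, _⟩ | ⟨h, _⟩), _⟩
        · exact absurd h1 h
        · exact absurd hl h
        · exact absurd h1 h
      · rintro (⟨h, _⟩ | ⟨_, h, _⟩ | ⟨h, _⟩)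
        · exact absurd h1 h
        · exact absurd hl h
        · exact absurd h1 h
    · constructor
      · rintro ⟨(⟨h, _⟩ | ⟨_, _, hDn, hp⟩ | ⟨h, _⟩), hn⟩
        · exact absurd h1 h
        · refine Or.inr (Or.inl ⟨h1, hl, hDn, (hmemA _ _).mpr ⟨hDge ω _ ((D ω).min'_mem hDn),
            (D ω).min'_le _ ((D ω).max'_mem hDn), hDle ω _ ((D ω).max'_mem hDn), hp, fun hq => hn ?_⟩⟩)
          exact Or.inr (Or.inl ⟨h1, hl, hDn, hq⟩)
        · exact absurd h1 h
      · rintro (⟨h, _⟩ | ⟨_, _, hDn, hA'⟩ | ⟨h, _⟩)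
        · exact absurd h1 h
        · obtain ⟨_, _, _, hp, hq⟩ := (hmemA _ _).mp hA'
          refine ⟨Or.inr (Or.inl ⟨h1, hl, hDn, hp⟩), ?_⟩
          rintro (⟨_, h, _⟩ | ⟨_, _, _, h⟩ | ⟨h, _⟩)
          · exact absurd h hl
          · exact hq h
          · exact absurd h1 h
        · exact absurd h1 h
    · constructor
      · rintro ⟨(⟨_, h, _⟩ | ⟨h, _⟩ | ⟨_, _, hDn, hq⟩), hn⟩
        · exact absurd hl h
        · exact absurd h h1
        · refine Or.inr (Or.inr ⟨h1, hl, hDn, (hmemB _ _).mpr ⟨hDge ω _ ((D ω).min'_mem hDn),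
            (D ω).min'_le _ ((D ω).max'_mem hDn), hDle ω _ ((D ω).max'_mem hDn), hq, fun hp => hn ?_⟩⟩)
          exact Or.inr (Or.inr ⟨h1, hl, hDn, hp⟩)
      · rintro (⟨_, h, _⟩ | ⟨h, _⟩ | ⟨_, _, hDn, hB'⟩)
        · exact absurd hl h
        · exact absurd h h1
        · obtain ⟨_, _, _, hq, hp⟩ := (hmemB _ _).mp hB'
          refine ⟨Or.inr (Or.inr ⟨h1, hl, hDn, hq⟩), ?_⟩
          rintro (⟨h, _⟩ | ⟨h, _⟩ | ⟨_, _, _, h⟩)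
          · exact absurd h h1
          · exact absurd h h1
          · exact hp h
    · constructor
      · rintro ⟨(⟨_, _, h⟩ | ⟨h, _⟩ | ⟨_, h, _⟩), _⟩
        · exact Or.inl ⟨h1, hl, h⟩
        · exact absurd h h1
        · exact absurd h hl
      · rintro (⟨_, _, h⟩ | ⟨h, _⟩ | ⟨_, h, _⟩)
        · refine ⟨Or.inl ⟨h1, hl, h⟩, ?_⟩
          rintro (⟨h', _⟩ | ⟨h', _⟩ | ⟨_, h', _⟩)
          · exact h1 h'
          · exact h1 h'
          · exact hl h'
        · exact absurd h h1
        · exact absurd h hl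
  have hT' : ∀ ω, T ω ↔ ω ⊆ Icc 1 ℓ ∧
      ((1 ∈ ω ∧ ℓ ∈ ω ∧ (D ω = ∅ ∨ ∃ h : (D ω).Nonempty, (D ω).max' h ≤ om ((D ω).min' h))) ∨
       (1 ∈ ω ∧ ℓ ∉ ω ∧ ∃ h : (D ω).Nonempty, ((D ω).min' h, (D ω).max' h) ∈ B) ∨
       (1 ∉ ω ∧ ℓ ∈ ω ∧ ∃ h : (D ω).Nonempty, ((D ω).min' h, (D ω).max' h) ∈ A)) := by
    intro ω
    rw [hT]
    refine and_congr_right fun hω => ?_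
    obtain ⟨hWl, hcWl⟩ := hlevels ω hω
    rw [hWl, hcWl]
    by_cases h1 : 1 ∈ ω <;> by_cases hl : ℓ ∈ ω
    · constructor
      · rintro ⟨(⟨_, _, h⟩ | ⟨_, h, _⟩ | ⟨h, _⟩), _⟩
        · exact Or.inl ⟨h1, hl, h⟩
        · exact absurd hl h
        · exact absurd h1 h
      · rintro (⟨_, _, h⟩ | ⟨_, h, _⟩ | ⟨h, _⟩)
        · refine ⟨Or.inl ⟨h1, hl, h⟩, ?_⟩
          rintro (⟨h', _⟩ | ⟨_, h', _⟩ | ⟨h', _⟩)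
          · exact h' h1
          · exact h' hl
          · exact h' h1
        · exact absurd hl h
        · exact absurd h1 h
    · constructor
      · rintro ⟨(⟨_, h, _⟩ | ⟨_, _, hDn, hq⟩ | ⟨h, _⟩), hn⟩
        · exact absurd h hl
        · refine Or.inr (Or.inl ⟨h1, hl, hDn, (hmemB _ _).mpr ⟨hDge ω _ ((D ω).min'_mem hDn),
            (D ω).min'_le _ ((D ω).max'_mem hDn), hDle ω _ ((D ω).max'_mem hDn), hq, fun hp => hn ?_⟩⟩)
          exact Or.inr (Or.inl ⟨h1, hl, hDn, hp⟩)
        · exact absurd h1 h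
      · rintro (⟨_, h, _⟩ | ⟨_, _, hDn, hB'⟩ | ⟨h, _⟩)
        · exact absurd h hl
        · obtain ⟨_, _, _, hq, hp⟩ := (hmemB _ _).mp hB'
          refine ⟨Or.inr (Or.inl ⟨h1, hl, hDn, hq⟩), ?_⟩
          rintro (⟨h, _⟩ | ⟨_, _, _, h⟩ | ⟨h, _⟩)
          · exact absurd h1 h
          · exact hp h
          · exact absurd h1 h
        · exact absurd h1 h
    · constructor
      · rintro ⟨(⟨h, _⟩ | ⟨h, _⟩ | ⟨_, _, hDn, hp⟩), hn⟩
        · exact absurd h h1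
        · exact absurd h h1
        · refine Or.inr (Or.inr ⟨h1, hl, hDn, (hmemA _ _).mpr ⟨hDge ω _ ((D ω).min'_mem hDn),
            (D ω).min'_le _ ((D ω).max'_mem hDn), hDle ω _ ((D ω).max'_mem hDn), hp, fun hq => hn ?_⟩⟩)
          exact Or.inr (Or.inr ⟨h1, hl, hDn, hq⟩)
      · rintro (⟨h, _⟩ | ⟨h, _⟩ | ⟨_, _, hDn, hA'⟩)
        · exact absurd h h1
        · exact absurd h h1
        · obtain ⟨_, _, _, hp, hq⟩ := (hmemA _ _).mp hA'
          refine ⟨Or.inr (Or.inr ⟨h1, hl, hDn, hp⟩), ?_⟩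
          rintro (⟨_, h, _⟩ | ⟨h, _⟩ | ⟨_, _, _, h⟩)
          · exact absurd hl h
          · exact absurd h h1
          · exact hq h
    · constructor
      · rintro ⟨(⟨h, _⟩ | ⟨h, _⟩ | ⟨_, h, _⟩), _⟩
        · exact absurd h h1
        · exact absurd h h1
        · exact absurd h hl
      · rintro (⟨h, _⟩ | ⟨h, _⟩ | ⟨_, h, _⟩)
        · exact absurd h h1
        · exact absurd h h1
        · exact absurd h hl
  ------------------------------------------------------------------ transport and count
  obtain ⟨Φ, hΦ, hΦinj⟩ := hubPath_core ℓ hℓ om A B hstair hmono hAcell hAdown hBcell hBup hAB D hD S T hS' hT'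
  have hWf : F.filter (fun ω => W ω) = F.filter (fun ω => ω ⊆ Icc 1 ℓ ∧ W ω) := by
    ext ω; simp only [Finset.mem_filter]
    exact ⟨fun ⟨hF, hw⟩ => ⟨hF, hFsub ω hF, hw⟩, fun ⟨hF, _, hw⟩ => ⟨hF, hw⟩⟩
  have hcWf : F.filter (fun ω => cW ω) = F.filter (fun ω => ω ⊆ Icc 1 ℓ ∧ cW ω) := by
    ext ω; simp only [Finset.mem_filter]
    exact ⟨fun ⟨hF, hw⟩ => ⟨hF, hFsub ω hF, hw⟩, fun ⟨hF, _, hw⟩ => ⟨hF, hw⟩⟩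
  rw [hWf, hcWf]
  refine hub_card_filter_le_of_moveInjection F (fun ω => ω ⊆ Icc 1 ℓ ∧ W ω) (fun ω => ω ⊆ Icc 1 ℓ ∧ cW ω)
    (fun ω ω' => ∃ a b : ℕ, a ≤ b ∧ b ≤ ℓ ∧ ω' = ω ∪ Icc 1 a ∪ Icc (b + 1) ℓ ∧ (∀ k ∈ ω, a < k) ∧ (∀ k ∈ ω, k ≤ b))
    ?_ Φ ?_ ?_
  · rintro ω hω ω' ⟨a, b, hab, hb, rfl, hlead, htrail⟩
    exact hFup ω hω a b hab hb hlead htrail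
  · rintro ω ⟨hω, hw⟩ hnc
    have hSω : S ω := (hS ω).mpr ⟨hω, hw, fun h => hnc ⟨hω, h⟩⟩
    obtain ⟨hTΦ, a, b, hab, hb, hΦω, hlead, htrail⟩ := hΦ ω hSω
    obtain ⟨hΦsub, hcw, hnw⟩ := (hT _).mp hTΦ
    exact ⟨⟨hΦsub, hcw⟩, fun h => hnw h.2, a, b, hab, hb, hΦω, hlead, htrail⟩
  · rintro ω ω' ⟨hω, hw⟩ hnc ⟨hω', hw'⟩ hnc' h
    exact hΦinj ω ω' ((hS ω).mpr ⟨hω, hw, fun h' => hnc ⟨hω, h'⟩⟩)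
      ((hS ω').mpr ⟨hω', hw', fun h' => hnc' ⟨hω', h'⟩⟩) h

end Coefficientwise

end Summit.CriticalPhenomena.PercolationContinuityZ3.Theorems
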